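import Literature.Computability.Complexity.MPGSignVerifierWitness
import Literature.Computability.Complexity.MPGSignVerifierSound
import Literature.Computability.Complexity.MPGSignVerifierFP
import Literature.Combinatorics.Optimization.FeasiblePotentialWalks
import HarnessLib

/-!
# Mean-payoff games with real weights are in `NDP⁰_ℝovs` (digital nondeterministic additive polynomial time)

Topic `Literature/Computability/Complexity`, grouping namespace `MPGSignVerifier`, main result
`Literature.Computability.Complexity.MPGReal_mem_NDPAdd : MPGReal ∈ NDPAdd`: the real mean-payoff
language (`MeanPayoffGame.lean`: `x ∈ ℝⁿ`, `n = k + 2k²`, read as an arena on `k` vertices with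
owner bits, edge indicators and real weights; yes iff the arena is total and vertex `0` carries a
potential certificate `(σ, R, π)`) is accepted by a polynomial-time parameter-free machine over
`(ℝ, +, −, <)` with a Boolean witness, in the sign-oracle rendering of `AdditiveRealClasses.lean`
[FournierKoiran2000, §3: `NDP⁰_ℝovs`; by Fact 2 there (Koiran 1994) it equals `NP⁰_ℝovs`]. This is
the hypothesis `MPGRealMemNDPadd` of route `PneNP/NoTardosTropics`.

The machine is `MPGSignVerifier.verifier` (polynomial time `isPolyTime_verifier`, run
`run_verifier`, soundness `sound`). Completeness (**`complete`**): from a certificate `(σ, R, π)` —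
`π` an arbitrary REAL potential — `Literature.Combinatorics.Optimization.exists_shortWalkPotential`
[CLRS2009, Thm 24.9] replaces `π` by walk weights with multiplicities `< k`, which fit the `k`-bit
fields of the witness (`mkData`, `witness`); every check then passes (`checks_mk`) and the side
conditions hold (`sideOK_mk`). Witness length `≤ n³ + 4n² + 3n`; budget `X³ + 4X² + 5X + 3`.

## References

* H. Fournier, P. Koiran, *Lower bounds are not easier over the reals: inside PH*, ICALP 2000,
  §3 (`NDP⁰_ℝovs`, Fact 2, Thm 3) [FournierKoiran2000]; U. Zwick, M. Paterson, *The complexity of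
  mean payoff games on graphs*, TCS 158 (1996), Thm 7 [ZwickPaterson1995]; T. H. Cormen et al.,
  *Introduction to Algorithms*, 3rd ed., 2009, §24.4, Thm 24.9 [CLRS2009].
-/

namespace Literature.Computability.Complexity

namespace MPGSignVerifier

open _root_.Computability Literature.Combinatorics.Optimization Finset Polynomial

/-! ### The data of the canonical witness -/

section Data

variable (k : ℕ) (τ σ : Fin k → Fin k) (R : Set (Fin k)) (P : Fin k → List (Fin k))

/-- The weight coordinates traversed by a walk (with multiplicity). [folklore] -/
def walkIdxs (L : List (Fin k)) : List ℕ := (walkPairs L).map fun p => k + k * k + (p.1.val * k + p.2.val)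

/-- The data of the canonical witness of a certificate: totality map `τ`, Max's choice `σ`, the set
`R`, and the multiplicities of the weight coordinates in the walks `P v`. [folklore] -/
noncomputable def mkData : WData where
  tau u := if h : u < k then (τ ⟨u, h⟩).val else 0
  sig u := if h : u < k then (σ ⟨u, h⟩).val else 0
  inSet u := if h : u < k then @decide (⟨u, h⟩ ∈ R) (Classical.dec _) else false
  mult v i := if h : v < k then (walkIdxs k (P ⟨v, h⟩)).count i else 0

variable {k τ σ R P} {g : ℕ → ℝ}

/-- `inR` of the canonical witness is membership in `R`. [folklore] -/
theorem inR_mk {u : ℕ} (hu : u < k) :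
    inR (env k (witness k g (mkData k τ σ R P))) u = @decide (⟨u, hu⟩ ∈ R) (Classical.dec _) := by
  rw [inR_witness hu, mkData]; dsimp only; rw [dif_pos hu]

/-- `inR` of the canonical witness, as an equivalence. [folklore] -/
theorem inR_mk_iff {u : ℕ} (hu : u < k) :
    inR (env k (witness k g (mkData k τ σ R P))) u = true ↔ (⟨u, hu⟩ : Fin k) ∈ R := by
  rw [inR_mk hu]; simp only [decide_eq_true_eq]

/-- `tot` of the canonical witness is `τ`. [folklore] -/
theorem tot_mk {u : ℕ} (hu : u < k) : tot (env k (witness k g (mkData k τ σ R P))) u = (τ ⟨u, hu⟩).val := by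
  have h : (mkData k τ σ R P).tau u = (τ ⟨u, hu⟩).val := by rw [mkData]; dsimp only; rw [dif_pos hu]
  rw [tot_witness hu (by rw [h]; exact (τ _).isLt), h]

/-- `succ` of the canonical witness is `σ`. [folklore] -/
theorem succ_mk {u : ℕ} (hu : u < k) : succ (env k (witness k g (mkData k τ σ R P))) u = (σ ⟨u, hu⟩).val := by
  have h : (mkData k τ σ R P).sig u = (σ ⟨u, hu⟩).val := by rw [mkData]; dsimp only; rw [dif_pos hu]
  rw [succ_witness hu (by rw [h]; exact (σ _).isLt), h]

/-- `coef` of the canonical witness is the multiplicity (for short walks). [folklore] -/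
theorem coef_mk {v i : ℕ} (hv : v < k) (hi : i < k + 2 * k * k) (hP : (P ⟨v, hv⟩).length ≤ k) :
    coef (env k (witness k g (mkData k τ σ R P))) v i = (walkIdxs k (P ⟨v, hv⟩)).count i := by
  have h : (mkData k τ σ R P).mult v i = (walkIdxs k (P ⟨v, hv⟩)).count i := by
    rw [mkData]; dsimp only; rw [dif_pos hv]
  rw [coef_witness hv hi, h]
  rw [h]
  calc (walkIdxs k (P ⟨v, hv⟩)).count i ≤ (walkIdxs k (P ⟨v, hv⟩)).length := List.count_le_length
    _ < 2 ^ k := by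
      rw [walkIdxs, List.length_map, length_walkPairs]
      exact lt_of_le_of_lt (by omega) (Nat.lt_two_pow_self (n := k))

/-- **The potential read off the canonical witness is the walk weight.** [cite: CLRS2009, Thm 24.9] -/
theorem pot_mk (x : Fin (k + 2 * k * k) → ℝ) (hg : ∀ i, x i = g i.val) {v : ℕ} (hv : v < k)
    (hP : (P ⟨v, hv⟩).length ≤ k) :
    pot (env k (witness k g (mkData k τ σ R P))) x v =
      walkWeight (fun a b : Fin k => g (k + k * k + (a.val * k + b.val))) (P ⟨v, hv⟩) := by
  set L := walkIdxs k (P ⟨v, hv⟩) with hL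
  have hmem : ∀ m ∈ L, m ∈ Finset.range (k + 2 * k * k) := by
    intro m hm
    obtain ⟨p, -, rfl⟩ := List.mem_map.1 hm
    exact Finset.mem_range.2 (wIdx_lt p.1.isLt p.2.isLt)
  calc pot (env k (witness k g (mkData k τ σ R P))) x v
      = ∑ i : Fin (k + 2 * k * k), (L.count i.val : ℝ) * g i.val := by
        refine Finset.sum_congr rfl fun i _ => ?_
        rw [coef_mk hv i.isLt hP, hg]
    _ = ∑ m ∈ Finset.range (k + 2 * k * k), (L.count m : ℝ) * g m :=
        Fin.sum_univ_eq_sum_range (fun m => (L.count m : ℝ) * g m) _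
    _ = (L.map g).sum := sum_count_mul_eq_sum_map _ g L hmem
    _ = walkWeight (fun a b : Fin k => g (k + k * k + (a.val * k + b.val))) (P ⟨v, hv⟩) := by
        rw [walkWeight_eq_sum_walkPairs, hL, walkIdxs, List.map_map]; rfl

end Data

/-! ### Every check passes -/

section Pass

variable {k : ℕ} (hk : 0 < k) (x : Fin (k + 2 * k * k) → ℝ) {g : ℕ → ℝ} (hg : ∀ i, x i = g i.val)
  {τ σ : Fin k → Fin k} {R : Set (Fin k)} {P : Fin k → List (Fin k)}
  (hτ : ∀ u : Fin k, g (k + (u.val * k + (τ u).val)) = 1)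
  (hR : ∀ u ∈ R, (g u.val = 1 → g (k + (u.val * k + (σ u).val)) = 1 ∧ σ u ∈ R) ∧
    (g u.val ≠ 1 → ∀ u' : Fin k, g (k + (u.val * k + u'.val)) = 1 → u' ∈ R))
  (hP : ∀ v : Fin k, (P v).length ≤ k ∧ ∀ u : Fin k,
    (u ∈ R ∧ ((g u.val = 1 ∧ v = σ u) ∨ (g u.val ≠ 1 ∧ g (k + (u.val * k + v.val)) = 1))) →
      walkWeight (fun a b : Fin k => g (k + k * k + (a.val * k + b.val))) (P v) ≤
        walkWeight (fun a b : Fin k => g (k + k * k + (a.val * k + b.val))) (P u) + g (k + k * k + (u.val * k + v.val)))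

/-- Shorthand for the environment of the canonical witness. [folklore] -/
local notation "E" => env k (witness k g (mkData k τ σ R P))

include hg

/-- `x_m ≥ 1` holds and is answered `true`. [folklore] -/
theorem geOne_true {m : ℕ} (hm : m < k + 2 * k * k) (h : 1 ≤ g m) :
    decide ((0 : ℝ) ≤ qv x (geOne (k + 2 * k * k) m)) = true :=
  decide_eq_true (by rw [qv_geOne x hm, hg]; linarith)

/-- `x_m ≥ 1` fails and is answered `false`. [folklore] -/
theorem geOne_false {m : ℕ} (hm : m < k + 2 * k * k) (h : g m < 1) :
    decide ((0 : ℝ) ≤ qv x (geOne (k + 2 * k * k) m)) = false :=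
  decide_eq_false (by rw [qv_geOne x hm, hg]; linarith)

/-- `x_m ≤ 1` holds and is answered `true`. [folklore] -/
theorem leOne_true {m : ℕ} (hm : m < k + 2 * k * k) (h : g m ≤ 1) :
    decide ((0 : ℝ) ≤ qv x (leOne (k + 2 * k * k) m)) = true :=
  decide_eq_true (by rw [qv_leOne x hm, hg]; linarith)

/-- `x_m ≤ 1` fails and is answered `false`. [folklore] -/
theorem leOne_false {m : ℕ} (hm : m < k + 2 * k * k) (h : 1 < g m) :
    decide ((0 : ℝ) ≤ qv x (leOne (k + 2 * k * k) m)) = false :=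
  decide_eq_false (by rw [qv_leOne x hm, hg]; linarith)

omit hg in
/-- The trivial slot passes. [folklore] -/
theorem triv_pass : decide ((0 : ℝ) ≤ qv x triv.1) = triv.2 := by simp [triv]

/-- Slot 1 passes. [folklore] -/
theorem slot1_pass {u : ℕ} (hu : u < k) : decide ((0 : ℝ) ≤ qv x (slot1 E u).1) = (slot1 E u).2 := by
  by_cases h1 : g u = 1
  · rw [show slot1 E u = (geOne (k + 2 * k * k) u, true) by simp [slot1, isMax_witness hu, h1]]
    exact geOne_true x hg (vtx_lt hu) h1.ge
  · by_cases h2 : g u < 1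
    · rw [show slot1 E u = (geOne (k + 2 * k * k) u, false) by simp [slot1, isMax_witness hu, side_witness hu, h1, h2]]
      exact geOne_false x hg (vtx_lt hu) h2
    · rw [show slot1 E u = (leOne (k + 2 * k * k) u, false) by simp [slot1, isMax_witness hu, side_witness hu, h1, h2]]
      exact leOne_false x hg (vtx_lt hu) (lt_of_le_of_ne (not_lt.1 h2) (Ne.symm h1))

/-- Slot 2 passes. [folklore] -/
theorem slot2_pass {u : ℕ} (hu : u < k) : decide ((0 : ℝ) ≤ qv x (slot2 E u).1) = (slot2 E u).2 := by
  by_cases h1 : g u = 1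
  · rw [show slot2 E u = (leOne (k + 2 * k * k) u, true) by simp [slot2, isMax_witness hu, h1]]
    exact leOne_true x hg (vtx_lt hu) h1.le
  · rw [show slot2 E u = triv by simp [slot2, isMax_witness hu, h1]]
    exact triv_pass x

include hτ in
/-- Slot 3 passes. [folklore] -/
theorem slot3_pass {u : ℕ} (hu : u < k) : decide ((0 : ℝ) ≤ qv x (slot3 E u).1) = (slot3 E u).2 := by
  rw [show slot3 E u = (geOne (k + 2 * k * k) (k + (u * k + (τ ⟨u, hu⟩).val)), true) by
    simp [slot3, tot_mk hu, edgeIdx]]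
  exact geOne_true x hg (edgeIdx_lt hu (τ _).isLt) (hτ ⟨u, hu⟩).ge

include hτ in
/-- Slot 4 passes. [folklore] -/
theorem slot4_pass {u : ℕ} (hu : u < k) : decide ((0 : ℝ) ≤ qv x (slot4 E u).1) = (slot4 E u).2 := by
  rw [show slot4 E u = (leOne (k + 2 * k * k) (k + (u * k + (τ ⟨u, hu⟩).val)), true) by
    simp [slot4, tot_mk hu, edgeIdx]]
  exact leOne_true x hg (edgeIdx_lt hu (τ _).isLt) (hτ ⟨u, hu⟩).le

include hR in
/-- Slot 5 passes. [folklore] -/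
theorem slot5_pass {u u' : ℕ} (hu : u < k) (hu' : u' < k) :
    decide ((0 : ℝ) ≤ qv x (slot5 E u u').1) = (slot5 E u u').2 := by
  by_cases hmem : (⟨u, hu⟩ : Fin k) ∈ R
  · by_cases h1 : g u = 1
    · by_cases hs : u' = (σ ⟨u, hu⟩).val
      · rw [show slot5 E u u' = (geOne (k + 2 * k * k) (k + (u * k + u')), true) by
          simp [slot5, inR_mk hu, isMax_witness hu, succ_mk hu, hmem, h1, hs, edgeIdx]]
        have := ((hR _ hmem).1 h1).1
        rw [← hs] at this
        exact geOne_true x hg (edgeIdx_lt hu hu') this.ge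
      · rw [show slot5 E u u' = triv by simp [slot5, inR_mk hu, isMax_witness hu, succ_mk hu, hmem, h1, hs]]
        exact triv_pass x
    · by_cases he : g (k + (u * k + u')) = 1
      · rw [show slot5 E u u' = triv by simp [slot5, inR_mk hu, isMax_witness hu, noEdge_witness hu hu', hmem, h1, he]]
        exact triv_pass x
      · by_cases hl : g (k + (u * k + u')) < 1
        · rw [show slot5 E u u' = (geOne (k + 2 * k * k) (k + (u * k + u')), false) by
            simp [slot5, inR_mk hu, isMax_witness hu, noEdge_witness hu hu', noEdgeSide_witness hu hu', hmem, h1, he, hl,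
              edgeIdx]]
          exact geOne_false x hg (edgeIdx_lt hu hu') hl
        · rw [show slot5 E u u' = (leOne (k + 2 * k * k) (k + (u * k + u')), false) by
            simp [slot5, inR_mk hu, isMax_witness hu, noEdge_witness hu hu', noEdgeSide_witness hu hu', hmem, h1, he, hl,
              edgeIdx]]
          exact leOne_false x hg (edgeIdx_lt hu hu') (lt_of_le_of_ne (not_lt.1 hl) (Ne.symm he))
  · rw [show slot5 E u u' = triv by simp [slot5, inR_mk hu, hmem]]
    exact triv_pass x

include hR hP in
/-- Slot 6 passes. [folklore] -/
theorem slot6_pass {u u' : ℕ} (hu : u < k) (hu' : u' < k) :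
    decide ((0 : ℝ) ≤ qv x (slot6 E u u').1) = (slot6 E u u').2 := by
  by_cases hmem : (⟨u, hu⟩ : Fin k) ∈ R
  · by_cases h1 : g u = 1
    · by_cases hs : u' = (σ ⟨u, hu⟩).val
      · rw [show slot6 E u u' = (leOne (k + 2 * k * k) (k + (u * k + u')), true) by
          simp [slot6, inR_mk hu, isMax_witness hu, succ_mk hu, hmem, h1, hs, edgeIdx]]
        have := ((hR _ hmem).1 h1).1
        rw [← hs] at this
        exact leOne_true x hg (edgeIdx_lt hu hu') this.le
      · rw [show slot6 E u u' = triv by simp [slot6, inR_mk hu, isMax_witness hu, succ_mk hu, hmem, h1, hs]]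
        exact triv_pass x
    · by_cases he : g (k + (u * k + u')) = 1
      · rw [show slot6 E u u' = (potQ E u u', true) by
          simp [slot6, inR_mk hu, isMax_witness hu, noEdge_witness hu hu', hmem, h1, he]]
        refine decide_eq_true ?_
        rw [qv_potQ_env x _ hu hu', pot_mk x hg hu (hP _).1, pot_mk x hg hu' (hP _).1, hg]
        have := (hP ⟨u', hu'⟩).2 ⟨u, hu⟩ ⟨hmem, Or.inr ⟨h1, he⟩⟩
        dsimp only at this ⊢
        linarith
      · rw [show slot6 E u u' = triv by simp [slot6, inR_mk hu, isMax_witness hu, noEdge_witness hu hu', hmem, h1, he]]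
        exact triv_pass x
  · rw [show slot6 E u u' = triv by simp [slot6, inR_mk hu, hmem]]
    exact triv_pass x

include hP in
/-- Slot 7 passes. [folklore] -/
theorem slot7_pass {u u' : ℕ} (hu : u < k) (hu' : u' < k) :
    decide ((0 : ℝ) ≤ qv x (slot7 E u u').1) = (slot7 E u u').2 := by
  by_cases hc : (inR E u && isMax E u && decide (u' = succ E u)) = true
  · rw [slot7, if_pos hc]
    simp only [Bool.and_eq_true, decide_eq_true_eq, inR_mk hu, isMax_witness hu, succ_mk hu] at hc
    obtain ⟨⟨hmem, h1⟩, hs⟩ := hc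
    refine decide_eq_true ?_
    rw [qv_potQ_env x _ hu hu', pot_mk x hg hu (hP _).1, pot_mk x hg hu' (hP _).1, hg]
    have := (hP ⟨u', hu'⟩).2 ⟨u, hu⟩ ⟨hmem, Or.inl ⟨h1, Fin.ext hs⟩⟩
    dsimp only at this ⊢
    linarith
  · rw [slot7, if_neg hc]
    exact triv_pass x

omit hg in
/-- Every check is one of the slots. [folklore] -/
theorem exists_slot_of_mem_checks (e : Env) {c : List ℤ × Bool} (hc : c ∈ checks e) :
    (∃ u, u < kOf e ∧ (c = slot1 e u ∨ c = slot2 e u ∨ c = slot3 e u ∨ c = slot4 e u)) ∨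
    (∃ u u', u < kOf e ∧ u' < kOf e ∧ (c = slot5 e u u' ∨ c = slot6 e u u' ∨ c = slot7 e u u')) := by
  simp only [checks, List.mem_append, List.mem_flatten, List.mem_map, List.mem_range, rowSlots] at hc
  rcases hc with ⟨l, ⟨u, hu, rfl⟩, hc⟩ | ⟨l, ⟨u, hu, rfl⟩, hc⟩
  · left
    refine ⟨u, hu, ?_⟩
    simpa [vertexSlots] using hc
  · right
    simp only [List.mem_flatten, List.mem_map, List.mem_range] at hc
    obtain ⟨l', ⟨u', hu', rfl⟩, hc⟩ := hc
    refine ⟨u, u', hu, hu', ?_⟩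
    simpa [pairSlots] using hc

include hτ hR hP in
/-- **Every check of the canonical witness passes.** [folklore] -/
theorem checks_mk : ∀ c ∈ checks E, decide ((0 : ℝ) ≤ qv x c.1) = c.2 := by
  intro c hc
  rcases exists_slot_of_mem_checks _ hc with ⟨u, hu, h | h | h | h⟩ | ⟨u, u', hu, hu', h | h | h⟩ <;>
    rw [kOf_env] at hu
  · subst h; exact slot1_pass x hg hu
  · subst h; exact slot2_pass x hg hu
  · subst h; exact slot3_pass x hg hτ hu
  · subst h; exact slot4_pass x hg hτ hu
  all_goals rw [kOf_env] at hu'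
  · subst h; exact slot5_pass x hg hR hu hu'
  · subst h; exact slot6_pass x hg hR hP hu hu'
  · subst h; exact slot7_pass x hg hP hu hu'

omit hg in
include hk hR in
/-- **The side conditions hold for the canonical witness** (given `0 ∈ R`). [folklore] -/
theorem sideOK_mk (h0 : (⟨0, hk⟩ : Fin k) ∈ R) : sideOK E = true := by
  rw [sideOK, Bool.and_eq_true]
  refine ⟨(inR_mk_iff hk).2 h0, List.all_eq_true.2 fun u hu => ?_⟩
  rw [kOf_env, List.mem_range] at hu
  by_cases hmem : (⟨u, hu⟩ : Fin k) ∈ R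
  · rw [(inR_mk_iff hu).2 hmem, Bool.not_true, Bool.false_or]
    by_cases h1 : g u = 1
    · have hc : decide (g u = 1) = true := by rw [decide_eq_true_eq]; exact h1
      rw [isMax_witness hu, if_pos hc, succ_mk hu, inR_mk_iff (σ ⟨u, hu⟩).isLt, Fin.eta]
      exact ((hR _ hmem).1 h1).2
    · have hc : ¬ decide (g u = 1) = true := by rw [decide_eq_true_eq]; exact h1
      rw [isMax_witness hu, if_neg hc]
      simp only [List.all_eq_true, Bool.or_eq_true, kOf_env, List.mem_range]
      intro u' hu'
      by_cases he : g (k + (u * k + u')) = 1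
      · exact Or.inr ((inR_mk_iff hu').2 ((hR _ hmem).2 h1 ⟨u', hu'⟩ he))
      · left
        rw [noEdge_witness hu hu', decide_eq_true_eq]
        exact he
  · have hin : inR E u = false := by
      rw [Bool.eq_false_iff]
      exact fun h => hmem ((inR_mk_iff hu).1 h)
    rw [hin]
    rfl

end Pass

/-! ### Completeness and the theorem -/

/-- **Completeness of the verifier.** Every `x ∈ MPGReal n` has a witness of length
`≤ n³ + 4n² + 3n` accepted on every transcript with at least `2n + 2` answers. The real potential
of the certificate is replaced by short-walk potentials (`exists_shortWalkPotential`), whose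
multiplicities fit the `k`-bit fields. [cite: FournierKoiran2000, §3 (NDP⁰_ℝovs); CLRS2009, Thm 24.9] -/
theorem complete {n : ℕ} (x : Fin n → ℝ) (hx : x ∈ MPGReal n) :
    ∃ y : List Bool, y.length ≤ n ^ 3 + 4 * n ^ 2 + 3 * n ∧
      ∀ N, 2 * n + 2 ≤ N → accepts (n, y) (answers x (n, y) N) = true := by
  obtain ⟨k, hk, hn, htot, σ, R, π, ⟨v₀, hv₀, hv₀0⟩, hcert⟩ := (mem_MPGReal_iff_mpgPred x).1 hx
  subst hn
  set g : ℕ → ℝ := fun m => (List.ofFn x).getD m 0 with hgdef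
  have hg : ∀ i, x i = g i.val := fun i => by rw [hgdef]; exact (getD_ofFn x i.isLt).symm
  choose τ hτ using htot
  -- the certificate edges and the walk potentials
  let Ed : Fin k → Fin k → Prop := fun u v =>
    u ∈ R ∧ ((g u.val = 1 ∧ v = σ u) ∨ (g u.val ≠ 1 ∧ g (k + (u.val * k + v.val)) = 1))
  let w : Fin k → Fin k → ℝ := fun a b => g (k + k * k + (a.val * k + b.val))
  have hπ : ∀ u v, Ed u v → π v ≤ π u + w u v := by
    rintro u v ⟨hu, ⟨h1, rfl⟩ | ⟨h1, he⟩⟩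
    · exact ((hcert u hu).1 h1).2.2
    · exact ((hcert u hu).2 h1 v he).2
  obtain ⟨P, hP⟩ := exists_shortWalkPotential hπ
  have hP' : ∀ v : Fin k, (P v).length ≤ k ∧ ∀ u : Fin k, Ed u v → walkWeight w (P v) ≤ walkWeight w (P u) + w u v :=
    fun v => ⟨by simpa using (hP v).2.2.1, (hP v).2.2.2⟩
  have hR' : ∀ u ∈ R, (g u.val = 1 → g (k + (u.val * k + (σ u).val)) = 1 ∧ σ u ∈ R) ∧
      (g u.val ≠ 1 → ∀ u' : Fin k, g (k + (u.val * k + u'.val)) = 1 → u' ∈ R) := fun u hu =>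
    ⟨fun h1 => ⟨((hcert u hu).1 h1).1, ((hcert u hu).1 h1).2.1⟩, fun h1 u' he => ((hcert u hu).2 h1 u' he).1⟩
  have h0 : (⟨0, hk⟩ : Fin k) ∈ R := by
    have : v₀ = ⟨0, hk⟩ := Fin.ext hv₀0
    exact this ▸ hv₀
  refine ⟨witness k g (mkData k τ σ R P), ?_, fun N hN => ?_⟩
  · -- length
    rw [length_witness]
    unfold numBase numCount
    have hkn : k ≤ k + 2 * k * k := Nat.le_add_right _ _
    have h2 : k * k ≤ (k + 2 * k * k) * (k + 2 * k * k) := Nat.mul_le_mul hkn hkn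
    have h3 : k * (k + 2 * k * k) * k ≤ (k + 2 * k * k) * (k + 2 * k * k) * (k + 2 * k * k) :=
      Nat.mul_le_mul (Nat.mul_le_mul hkn le_rfl) hkn
    nlinarith
  · -- acceptance
    rw [accepts, Bool.and_eq_true, Bool.and_eq_true]
    refine ⟨⟨(valid_eq_true_iff _).2 ⟨k, hk, rfl⟩, sideOK_mk hk hR' h0⟩, decide_eq_true ?_⟩
    exact (take_answers_eq_expected_iff x _ ((length_checks_env_le k _).trans hN)).2 (checks_mk x hg hτ hR' hP')

end MPGSignVerifier

open MPGSignVerifier Polynomial _root_.Computability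

/-- Length of a unary numeral. [folklore] -/
private theorem length_unaryEncodeNat'' (k : ℕ) : (unaryEncodeNat k).length = k := by
  induction k with
  | zero => rfl
  | succ k ih => rw [unaryEncodeNat, List.length_cons, ih]

/-- **Mean-payoff games with real weights are in `NDP⁰_ℝovs`**: the real mean-payoff language
`MPGReal` (total arena with a potential certificate at vertex `0` — "`ν(0) ≥ 0`") is accepted by
the polynomial-time sign-query verifier `MPGSignVerifier.verifier` with Boolean witnesses of length
`≤ q(n)` within `q(n)` rounds, `q = X³ + 4X² + 5X + 3`: `x ∈ MPGReal n ↔ ∃ y, |y| ≤ q(n) ∧` the run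
on `⟨1ⁿ, y⟩` against the sign oracle of `x` outputs `true`. (Digital nondeterminism suffices because
a feasible potential may be taken to be a short-walk potential, an integer combination of the
weights.) [cite: FournierKoiran2000, §3 (NDP⁰_ℝovs; Fact 2); ZwickPaterson1995, Thm 7] -/
theorem MPGReal_mem_NDPAdd : MPGReal ∈ NDPAdd := by
  refine ⟨verifier, isPolyTime_verifier, X ^ 3 + 4 * X ^ 2 + 5 * X + 3, fun n x => ⟨fun hx => ?_, ?_⟩⟩
  · obtain ⟨y, hy, hacc⟩ := complete x hx
    have heval : (X ^ 3 + 4 * X ^ 2 + 5 * X + 3 : Polynomial ℕ).eval n = n ^ 3 + 4 * n ^ 2 + 5 * n + 3 := by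
      simp
    have hlen : (boolPair (unaryEncodeNat n) y).length < (X ^ 3 + 4 * X ^ 2 + 5 * X + 3 : Polynomial ℕ).eval n := by
      rw [heval, length_boolPair, length_unaryEncodeNat'']
      omega
    refine ⟨y, hy.trans (by rw [heval]; omega), ?_⟩
    rw [run_verifier x n y hlen, hacc _ (by rw [length_boolPair, length_unaryEncodeNat'']; omega)]
  · rintro ⟨y, -, hrun⟩
    exact sound x y (by rw [length_boolPair, length_unaryEncodeNat'']; omega) (accepts_of_run_eq_some_true x n y hrun)

end Literature.Computability.Complexity
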